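import Mathlib
import Summits.MatrixMultiplication.MatrixMultiplication.Theses.LevelGradedCohnUmans

/-!
# `SnLevelDesigns` (stmt-MatrixMultiplication-7613), line `garnir-annihilator`: S2 `stub_decreasingCover` — patience-level cover (Greene/Mirsky)

Crux `Summit.MatrixMultiplication.MatrixMultiplication.Theses.LevelGradedCohnUmans.SnLevelDesigns`; skeleton
`Cruxes/SnLevelDesigns/Lines/garnir-annihilator.lean` (lead reshape, 7 registered stubs); this file proves the registered stub
`stub_decreasingCover` verbatim (name + signature, tree-only vocabulary) and lands `--supports stmt-MatrixMultiplication-7613`.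

A permutation with no increasing subsequence of length `n - k` is strictly decreasing on the blocks of a labelling
with at most `n - k - 1` blocks: label position `a` by (length of the longest increasing subsequence of `p` ending at
`a`) − 1; equal labels form decreasing subsequences and the number of labels is `lis(p) ≤ n - k - 1`.
-/

set_option linter.dupNamespace false

namespace Summit.MatrixMultiplication.MatrixMultiplication.Theorems.SnLevelDesigns

open scoped BigOperators

/-- Patience levels (dual Dilworth / Mirsky for the two-dimensional order `a < b ∧ p a < p b`):
if every finset on which `p` is strictly increasing has fewer than `m` elements, then there is a
level function `L : Fin n → ℕ` with values in `[1, m)` which strictly increases along every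
increasing pair `a < b`, `p a < p b`.  `L a` is the length of the longest increasing subsequence
of `p` ending at position `a`. -/
theorem dc_exists_level {n : ℕ} (p : Equiv.Perm (Fin n)) (m : ℕ)
    (hcard : ∀ s : Finset (Fin n), StrictMonoOn (⇑p) (s : Set (Fin n)) → s.card < m) :
    ∃ L : Fin n → ℕ, (∀ a, 1 ≤ L a ∧ L a < m) ∧
      ∀ a b, a < b → p a < p b → L a < L b := by
  classical
  -- the family of increasing subsequences of `p` ending at (and bounded by) position `a`
  obtain ⟨F, hmem⟩ : ∃ F : Fin n → Finset (Finset (Fin n)), ∀ a s, s ∈ F a ↔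
      (a ∈ s ∧ (∀ x ∈ s, x ≤ a) ∧ StrictMonoOn (⇑p) (s : Set (Fin n))) :=
    ⟨fun a => Finset.univ.filter
        (fun s => a ∈ s ∧ (∀ x ∈ s, x ≤ a) ∧ StrictMonoOn (⇑p) (s : Set (Fin n))),
      fun a s => by simp only [Finset.mem_filter, Finset.mem_univ, true_and]⟩
  have hsingle : ∀ a, ({a} : Finset (Fin n)) ∈ F a := by
    intro a
    rw [hmem]
    refine ⟨Finset.mem_singleton_self a, fun x hx => (Finset.mem_singleton.mp hx).le, ?_⟩
    rw [Finset.coe_singleton]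
    exact Set.strictMonoOn_singleton _
  have hbot : (⊥ : ℕ) < m := by
    have h := hcard ∅ (by rw [Finset.coe_empty]; exact Set.subsingleton_empty.strictMonoOn _)
    rw [Finset.card_empty] at h
    exact h
  refine ⟨fun a => (F a).sup Finset.card, fun a => ⟨?_, ?_⟩, fun a b hab hpab => ?_⟩
  · -- `1 ≤ L a`: the singleton `{a}` belongs to the family
    have h := Finset.le_sup (f := Finset.card) (hsingle a)
    rwa [Finset.card_singleton] at h
  · -- `L a < m`: every member of the family is an increasing subsequence
    rw [Finset.sup_lt_iff hbot]
    intro s hs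
    exact hcard s ((hmem a s).mp hs).2.2
  · -- strict increase along an increasing pair: extend a longest member of `F a` by `b`
    obtain ⟨s, hs, hsup⟩ := Finset.exists_mem_eq_sup (F a) ⟨{a}, hsingle a⟩ Finset.card
    obtain ⟨has, hle, hmono⟩ := (hmem a s).mp hs
    have hbs : b ∉ s := fun hb => absurd (hle b hb) (not_le.mpr hab)
    have hins : insert b s ∈ F b := by
      rw [hmem]
      refine ⟨Finset.mem_insert_self b s, ?_, ?_⟩
      · intro x hx
        rcases Finset.mem_insert.mp hx with hxb | hx
        · exact hxb.le
        · exact ((hle x hx).trans hab.le)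
      · rw [Finset.coe_insert]
        intro x hx y hy hxy
        rcases Set.mem_insert_iff.mp hy with hyb | hy'
        · -- `y = b`, so `x ∈ s` and `p x ≤ p a < p b`
          have hx' : x ∈ s := by
            rcases Set.mem_insert_iff.mp hx with hxb | hx'
            · exact absurd hxy (by rw [hxb, hyb]; exact lt_irrefl _)
            · exact Finset.mem_coe.mp hx'
          rw [hyb]
          exact (hmono.monotoneOn (Finset.mem_coe.mpr hx') (Finset.mem_coe.mpr has)
            (hle x hx')).trans_lt hpab
        · -- `y ∈ s`, so `x < y ≤ a < b` and `x ∈ s`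
          have hy'' : y ∈ s := Finset.mem_coe.mp hy'
          have hx' : x ∈ s := by
            rcases Set.mem_insert_iff.mp hx with hxb | hx'
            · exact absurd (hxy.trans_le ((hle y hy'').trans hab.le))
                (by rw [hxb]; exact lt_irrefl _)
            · exact Finset.mem_coe.mp hx'
          exact hmono (Finset.mem_coe.mpr hx') hy' hxy
    have h1 : (insert b s).card ≤ (F b).sup Finset.card := Finset.le_sup (f := Finset.card) hins
    rw [Finset.card_insert_of_notMem hbs] at h1
    show (F a).sup Finset.card < (F b).sup Finset.card
    rw [hsup]
    exact h1

/-- **`stub_decreasingCover`** (registered stub of crux stmt-MatrixMultiplication-7613,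
line `garnir-annihilator`). A permutation `p` of `Fin n` with no increasing subsequence of length
`n - k` is strictly decreasing on the blocks (fibres) of a labelling `blk : Fin n → Fin n` with at
most `n - k - 1` blocks: label each position by its patience level (length of the longest
increasing subsequence ending there) minus one. -/
theorem stub_decreasingCover :
    ∀ (n k : ℕ) (p : Equiv.Perm (Fin n)),
      (¬ ∃ s : Finset (Fin n), n - k ≤ s.card ∧ StrictMonoOn (⇑p) (s : Set (Fin n))) →
        ∃ blk : Fin n → Fin n, (Finset.univ.image blk).card + k + 1 ≤ n ∧
          ∀ a b : Fin n, blk a = blk b → a < b → p b < p a := by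
  intro n k p hp
  classical
  have hcard : ∀ s : Finset (Fin n), StrictMonoOn (⇑p) (s : Set (Fin n)) → s.card < n - k :=
    fun s hs => not_le.mp fun h => hp ⟨s, h, hs⟩
  have h0 : 0 < n - k := by
    have h := hcard ∅ (by rw [Finset.coe_empty]; exact Set.subsingleton_empty.strictMonoOn _)
    rwa [Finset.card_empty] at h
  obtain ⟨L, hL, hmono⟩ := dc_exists_level p (n - k) hcard
  have hLn : ∀ a, L a - 1 < n := fun a => by have h := (hL a).2; omega
  obtain ⟨blk, hblk⟩ : ∃ blk : Fin n → Fin n, ∀ a, (blk a : ℕ) = L a - 1 :=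
    ⟨fun a => ⟨L a - 1, hLn a⟩, fun a => rfl⟩
  refine ⟨blk, ?_, ?_⟩
  · -- number of blocks: the labels are `< n - k - 1`
    have hle : (Finset.univ.image blk).card ≤ (Finset.range (n - k - 1)).card := by
      refine Finset.card_le_card_of_injOn (fun i : Fin n => (i : ℕ)) ?_ Fin.val_injective.injOn
      intro i hi
      obtain ⟨a, -, rfl⟩ := Finset.mem_image.mp (Finset.mem_coe.mp hi)
      rw [Finset.mem_coe, Finset.mem_range]
      show (blk a : ℕ) < n - k - 1
      have h := hL a
      rw [hblk a]
      omega
    rw [Finset.card_range] at hle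
    omega
  · -- `p` is strictly decreasing on each block
    intro a b hab hlt
    have hval : (blk a : ℕ) = blk b := congrArg Fin.val hab
    rw [hblk a, hblk b] at hval
    have hLab : L a = L b := by have ha := (hL a).1; have hb := (hL b).1; omega
    by_contra h
    have hne : p a ≠ p b := fun h' => (ne_of_lt hlt) (p.injective h')
    have hpab : p a < p b := lt_of_le_of_ne (not_lt.mp h) hne
    exact absurd (hmono a b hlt hpab) (by rw [hLab]; exact lt_irrefl _)

end Summit.MatrixMultiplication.MatrixMultiplication.Theorems.SnLevelDesigns
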